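import Mathlib
import HarnessLib
import HarnessLib.Audit
import Summits.HubbardSuperconductivity.Statement
import HarnessLib.Audit.Status.Attr

/-!
Route: NoGo

CLOSED (retired) 2026-08-16T03:32:20Z by planner-rchoice-HubbardSuperconductivity-NoGo--3c5203b9-0 — reason: not-a-thesis (route.target-unreachable, operator hold 2026-08-16T02:56:57Z): no crux reaches the target NogoThesisR = ¬S — the cruxes are regional restrictions OF the target, and no honest glue exists: every cover of the (U,δ) box must incl — note: ROUTE-CHOICE census (planner rchoice 3c5203b9; full memo = evidence ROUTE-CHOICE.md on this route and on stmt-2136). OPTIONS REJECTED: (a) a bare support `NogoNagaokaCorner → NogoStripeWindowR → NogoStripePoint → NogoThesisR` hides the uncovered sector (incl. weak coupling) in an implication — costu. The file is kept as the record of this route; refuted decls are indexed as negative knowledge (`ledger negatives`).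

# Route NoGo — HubbardSuperconductivity, negative side by REGIONAL exclusion (repaired 2026-08-15 to
the audited Statement; rev 8 tenure 2026-08-15)

## Thesis
X = NogoThesisR := ¬HubbardSuperconductivity pushed through the quantifiers in the AUDITED typing:
for EVERY U > 0 and EVERY δ ∈ (0, 1/2) there are N, ψ meeting the summit's hypotheses (N_L =
2⌊(1−δ)L²/2⌋, ψ_L a normalised (N_L, S^z = 0)-sector ground state of hubbardTorus 2 L 1 U at every
EVEN side L) WITHOUT even-side d_{x²−y²} pair-field long-range order (¬HasLongRangeOrder of
torusPullback (pairFieldCorr dWaveFormFactor ψ) (2k) over halfOpenBox 2 (2k)). X ↔ ¬S by pure logic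
(kernel-checked: Theorems/NoGoNogoThesis.lean `not_hubbardSuperconductivity_iff`, p38573). The decl
is SHARED with SignStructure.Target (stmt-HubbardSuperconductivity-2136, identical signature): one
statement, two decompositions — SignStructure by witness CLASSES, this route by REGIONS of the (U,
δ) plane.
Lean: `∀ U : ℝ, 0 < U → ∀ δ ∈ Set.Ioo (0:ℝ) (1/2), ∃ (N : ℕ → ℕ) (ψ : ∀ L,
Literature.MathematicalPhysics.QuantumLattice.Fock
(Literature.MathematicalPhysics.QuantumLattice.Orb
(Literature.MathematicalPhysics.QuantumLattice.FermionTorus 2 L))), (∀ L, Even L → N L = 2 * ⌊(1 -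
δ) * (L : ℝ) ^ 2 / 2⌋₊ ∧ star (ψ L) ⬝ᵥ ψ L = 1 ∧
Literature.MathematicalPhysics.QuantumLattice.IsGroundStateInSector
(Literature.MathematicalPhysics.QuantumLattice.hubbardTorus 2 L 1 U) (N L) 0 (ψ L)) ∧ ¬
Literature.Probability.LatticeModels.HasLongRangeOrder (fun k =>
Literature.Probability.LatticeModels.halfOpenBox 2 (2 * k)) (fun k =>
Literature.MathematicalPhysics.QuantumLattice.torusPullback
(Literature.MathematicalPhysics.QuantumLattice.pairFieldCorr
Literature.MathematicalPhysics.QuantumLattice.dWaveFormFactor ψ) (2 * k))`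

## Assembly
Deciding theorem (glue.lean; three lines of logic; native audit ok, conclusion = negation of the
Statement decl): `theorem closes (h : NogoThesisR) : ¬ HubbardSuperconductivity` — rintro ⟨U, hU, δ,
hδ, hall⟩; obtain ⟨N, ψ, hyp, hno⟩ := h U hU δ hδ; exact hno (hall N ψ hyp). The cruxes
NogoNagaokaCorner (rank 2), NogoStripePoint (rank 3; the (U, δ) = (8, 1/8) POINT, decl shared with
PlateauExclusion.StripePointExclusion, stmt-HubbardSuperconductivity-10962) and NogoStripeWindowR
(rank 4 in the ranking; the [6, 8] × [1/10, 1/6] BOX) are X restricted to a point / sub-regions (X ⟹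
each, rc0 in Sketch.lean); they are partial progress toward X and enter `closes` only through X. Rev
8 (tenure g3, 2026-08-15): (a) the point crux is added because two of the four sibling engines
(PlateauExclusion, AbsenceCertificate) reach only the point, not the box (refuter route review D1 on
stmt-10834); (b) the provable-now support NogoNoSaturationBelowExchange (no saturated sector ground
state once δ < 1/(4(U+2)); dimer-singlet product state versus the spinless-fermion energy of S_max
states) is added on the corner branch: it makes the doping dependence of the corner's threshold a
theorem (U₁(δ) ≥ 1/(4δ) − 2 in NogoSaturatedFmCorner) and it REFUTES the U-uniform hypothesis hFM of
the legacy conditional theorem nogoNagaokaWindow_of_saturatedFerromagnetism (Sketch.lean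
`not_hFM_of_noSat`, rc0) — which is why hFM is not registered as an item (standing tree.conditional
flag: it clears when that legacy module, broken since rev 7, is ported WITHOUT the hFM corollary).
Rev 7 (tenure / priority repair 2026-08-15): (a) the PROVED support NogoSingletPairKillsSaturatedFM
(stmt-HubbardSuperconductivity-0172, p39832) is DETACHED from the item list — its `_holds` link made
the gate import Theorems/NoGoNogoSingletPairKillsSaturatedFM.lean, which imports this very file
(cycle: route unmaterialisable, `closes` unauditable at rev 6); the selection rule stays proved on
the ledger and in that Theorems file, whose main theorem is typed by the detached decl and needs a
one-line port (spell the type out; template PortNoGoSelectionRule.lean attached to stmt-10833)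
before the module builds again; (b) the saturated-ferromagnetism INPUT of the corner is REGISTERED
as the support item NogoSaturatedFmCorner in the audited typing of the rank-2 crux (δ₁ < 1/2,
doping-dependent threshold U₁(δ), even sides), and `NogoSaturatedFmCorner → NogoNagaokaCorner` is
kernel-checked (planner sketch corner_of_fmCorner; refuter helper
nogoNagaokaCorner_of_saturatedFerromagnetism_even; both rc0) — the U-uniform hypothesis hFM of the
legacy corollary nogoNagaokaWindow_of_saturatedFerromagnetism (pre-audit support NogoNagaokaWindow)
is NOT registered: it is refutable (rev 8 (b)). The pre-audit items NogoThesis (U ≠ 0, δ < 1, all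
sides, ¬HasPairFieldLRO), NogoAttractiveExclusion (U < 0), NogoNagaokaWindow and NogoStripeWindow
stay in the file as SUPPORT (their decls are named by Theorems/NoGoNogoThesis.lean); the item
`Assembly` is `NogoThesisR → ¬HubbardSuperconductivity` (rev 5). PROVERS / REFUTERS: a Theorems file
of this route must NOT `import …Theses.NoGo`, directly or transitively — spell the item's type out
(imports: Summits.HubbardSuperconductivity.Statement + Literature modules). The gate links
`<Decl>_holds := _root_.<your theorem>` by importing your module into THIS file; a module that
imports this file cycles and freezes the whole route (the rev-6 blocker). The two legacy modules
Theorems/NoGoNogoThesis.lean and Theorems/NoGoNogoSingletPairKillsSaturatedFM.lean do import it: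
port them (most lemmas are already typed structurally) rather than build on them in a closing file.
HONEST PRIOR (unchanged since the survey): X is expected FALSE at weak coupling (Kohn–Luttinger /
perturbative-RG d_{x²−y²} ground state for 0 < U ≪ t, 0.6 < n < 1: RaghuKivelsonScalapino2010
pp.2,6; ArovasBergKivelsonRaghu2022 §9). The route's value is REGIONAL: each crux proved removes a
region from the S-side search box, each crux refuted proves S outright.

Rationale: WHY THIS LINE. ¬S has no one-inequality proof at T = 0 in d = 2: the Koma–Tasaki / Mermin–Wagner
bounds are Gibbs-state statements degrading ∝ 1/β (KomaTasakiPRL1992 = arXiv:cond-mat/9709068 p.2;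
Tasaki1998 = arXiv:cond-mat/9512169 Thm 4.2) and KLS-type ground states DO order in d = 2, so a
negative-side route must assemble ¬S from REGIONAL exclusions, each a theorem of independent value
with its own mechanism. This route owns two regions. (i) The strong-coupling / small-doping CORNER:
mechanism = saturated (Nagaoka) ferromagnetism of the sector ground states + the exact SU(2)
selection rule 'a singlet pair field annihilates every S = N/2 state'
(NogoSingletPairKillsSaturatedFM — PROVED, Theorems/NoGoNogoSingletPairKillsSaturatedFM.lean,
p39832; detached from the item list at rev 7 so that the file materialises, see SUPPORT; the
ferromagnetic INPUT is registered as NogoSaturatedFmCorner and 'input + selection rule ⟹ corner' is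
kernel-checked in the planner sketch, corner_of_fmCorner), transplanted from Tasaki1998 p.25 (H_int
Ψ = 0 on S_max states) to Δ_d. (ii) The t' = 0 STRIPE REGIME, where DMRG + CP-AFQMC see filled
stripes and no superconductivity (QinEtAl2020 pp.1–2, 9; XuEtAl2024 p.1), filed as two bare regional
statements at which the sibling engine routes aim: the POINT (U, δ) = (8, 1/8) — NogoStripePoint,
word for word the catalogued open no-go PureModelStripeCompetition and the SAME decl as
PlateauExclusion.StripePointExclusion (stmt-10962), reached by PlateauExclusion (pair
incompressibility) and AbsenceCertificate (sourced-order / SDP one-point certificates); and the BOX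
U ∈ [6, 8], δ ∈ [1/10, 1/6] — NogoStripeWindowR, reached by CoboundaryCeiling
(StripeWindowCoboundary, box [6, 10] × [1/10, 1/6], every ground state) and SignStructure
(StripeWindowMembership = JastrowSlaterNoDWaveLRO → verbatim NogoStripeWindowR); the box implies the
point (rev 8: refuter route-review objection D1 — two of the four engines reach only the point).
Repair 2026-08-15: after the 2026-08-13 Statement audit (U > 0, δ ∈ (0, 1/2), even sides) the
pre-audit typings (U ≠ 0, δ < 1, all-sides liminf) neither imply nor follow from ¬S (odd-side gap:
Theorems/NoGoNogoThesis.lean nogoThesis_iff_frequently, not_hubbardSuperconductivity_iff); target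
and cruxes are re-filed in the audited typing and the deciding theorem is pure logic. Imported from
other areas: nothing beyond SU(2) representation theory and reflection-positivity folklore; physical
input is numerical evidence, cited not imported.

RANKED CRUXES. #2 NogoNagaokaCorner — ∃ δ₁ ∈ (0, 1/2) ∀ δ ∈ (0, δ₁) ∃ U₁ ∀ U > U₁: some admissible
(N_L, S^z = 0) ground-state sequence has no even-side d-wave pair-field LRO; the coupling threshold
depends on the doping, and rev 8 makes that dependence a THEOREM to prove: the support
NogoNoSaturationBelowExchange (no saturated sector ground state for δ < 1/(4(U+2)), i.e. U₁(δ) ≥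
1/(4δ) − 2 for the ferromagnetic mechanism; Richmond–Rickayzen 1969 / Shastry–Krishnamurthy–Anderson
1990 Fig. 2, book:editornd-hubbard-model pp.205–207: 'U_cr → ∞ as δ → 0'); its ferromagnetic input
is the registered support NogoSaturatedFmCorner, and NogoSaturatedFmCorner → NogoNagaokaCorner is
rc0 (planner sketch; refuter helper Helper.lean on stmt-10833) (why it might fail: finite-U,
positive-density saturated ferromagnetism is OPEN (Tasaki1998 p.26) and doubted — with TWO holes at
U = ∞ the saturated state is not the ground state on finite tori (Lieb 1993 review
arXiv:cond-mat/9311033 p.7 (iii)) while the summit's sectors always carry an even number ≥ 2 of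
holes; single-spin-flip variational instability for δ > 0.49 → 0.29 (Shastry–Krishnamurthy–Anderson,
von der Linden–Edwards; book:editornd-hubbard-model pp.200–209); a partially polarised or
phase-separated ground state gets nothing from the selection rule; sources: Tasaki1998, Nagaoka1966,
Tasaki1989, arXiv:cond-mat/9311033, ArovasBergKivelsonRaghu2022 §5.2 p.17). #3 NogoStripePoint — at
(U, δ) = (8, 1/8) NOT every admissible ground-state sequence has even-side d-wave pair-field LRO (=
¬HasDWavePairFieldLROAt 8 (1/8) = PureModelStripeCompetition by Iff.rfl; decl shared with
PlateauExclusion.StripePointExclusion) (why it might fail: TDL evidence at this single point only —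
DMRG + CP-AFQMC filled λ = 8 stripes, Δ_∞(0) = 0.003(6) (QinEtAl2020 p.9 Fig. 9), constrained-path
bias, contested (Sorella2023 = arXiv:2101.07045 p.12 Fig. 12: uniform d-wave phases at δ ∈ (0.19,
0.252) for U = 8, stripes AT 1/8; MaierEtAl2005 DCA d-wave; ArovasBergKivelsonRaghu2022 §8.1
'presently unsettled'); ¬crux is S itself at (8, 1/8), and no rigorous tool exists at U = 8t
(SignProblemNPHard); sources: QinEtAl2020, XuEtAl2024, Sorella2023, MaierEtAl2005,
Literature.Barriers.HubbardSuperconductivity.PureModelStripeCompetition). #4 NogoStripeWindowR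
(ledger rank 3, filed before the point) — for every U ∈ [6, 8] and δ ∈ [1/10, 1/6] some admissible
ground-state sequence has no even-side d-wave pair-field LRO; implies #3 (why it might fail: box
anchored by finite-cylinder scans only — QinEtAl2020 p.2 'U/t around 6–8, 0.1 < h < 0.2', p.7 Fig. 5
(h = 1/10, 1/8, 1/6 at U = 8), Fig. 11 (U = 4, 6, 8 at h = 1/8) — with the TDL extrapolation at (8,
1/8) alone; the corner (6, 1/6) is contested within method resolution: Sorella2023 p.12 Fig. 12 puts
a pure-model d_{x²−y²} phase at δ ∈ (0.17, 0.239) for U = 6, i.e. 0.003 above δ = 1/6, and the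
interior is unclaimed by any computation found (refuter D2); no rigorous tool at U = O(8t); sources:
QinEtAl2020 = arXiv:1910.08931, XuEtAl2024 = arXiv:2303.08376, Sorella2023 = arXiv:2101.07045,
MaierEtAl2005, Literature.Barriers.HubbardSuperconductivity.PureModelStripeCompetition).

KILL CRITERIA. The TARGET dies — and S is proved — with d_{x²−y²} pair-field LRO for every
admissible ground-state sequence at any single (U, δ) ∈ (0, ∞) × (0, 1/2); in particular if route
WeakCouplingBCS closes (cruxes WcbcsSsbToTorusLRO + WcbcsBcsConstruction; glue wcbcsThesis_of_cruxes
and hubbardSuperconductivity_of_evenThesis_half are landed in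
Theorems/WeakCouplingBCSWcbcsThesis.lean): then close this route refuted:NogoThesisR.
NogoNagaokaCorner's MECHANISM dies — i.e. ¬NogoSaturatedFmCorner — with a theorem that (N_L,
0)-sector ground states are unsaturated along infinitely many even sides at every small positive
hole density for arbitrarily large U (pivot: keep the statement only if another LRO-free witness —
phase separation, partial polarisation with controlled pair correlations — is in sight, else drop
the corner and keep the stripe window); NogoStripePoint dies with proved LRO at (8, 1/8) (and takes
the box with it); NogoStripeWindowR dies with proved LRO anywhere in [6, 8] × [1/10, 1/6] — if that
happens near the contested corner (6, 1/6) only, restate the box to δ ≤ 3/20 rather than close.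
Conversely each crux proved is reported to the S-side routes as an excluded region.

NOT DECOMPOSED YET. The corner is not formally SPLIT (D-0019: glued splits follow a close): its open
half 'positive-density Nagaoka ferromagnetism' is the registered support NogoSaturatedFmCorner, its
other half 'selection rule ⟹ no pair LRO on even sides' is landed mathematics
(pairFieldCorr_succ_eq_zero_of_saturated) and the glue NogoSaturatedFmCorner → NogoNagaokaCorner is
rc0 in the planner sketch, to be ported into Theorems by a prover (--supports NogoNagaokaCorner, no
Theses import); no engine is filed under NogoStripePoint / NogoStripeWindowR in this route (engines
live in PlateauExclusion / AbsenceCertificate (point) and CoboundaryCeiling / SignStructure (box)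
and close the shared decls directly or attach by --supports); the U-uniform ferromagnetic window hFM
of the legacy corollary nogoNagaokaWindow_of_saturatedFerromagnetism is NOT an item and never will
be: NogoNoSaturationBelowExchange ⟹ ¬hFM (Sketch.lean not_hFM_of_noSat, rc0), so the
tree.conditional flag is answered by porting that legacy module without the corollary
(prover/operator; the module has not built since rev 7 anyway); how regional exclusions could ever
cover weak coupling (they are not expected to); Pitaevskii–Stringari T = 0 inequalities (a no-go
only in d = 1); the degeneracy loophole (Δ_d†Δ_d is translation- and D₄-invariant, so momentum /
point-group degeneracy alone creates no LRO-free ground state — recorded so refuters do not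
re-derive it).

CHEAPEST FALSIFIER. Corner: the two-hole U = ∞ instability (Lieb review p.7 (iii)) says the witness
cannot literally be 'the saturated state at every large L' at fixed hole NUMBER; the cheap check is
exact diagonalisation of the 4 × 4 torus in the (14, S^z = 0) sector (= 2 holes, i.e. every δ ∈ (0,
1/8) at L = 4) at U = 50, 100, 200, ∞: if the sector ground state is unsaturated at every U, the
mechanism needs positive DENSITY rather than small hole number and the crux's why-might-fail is live
(kit ED, Hilbert dimension C(16,7)² ≈ 1.3·10⁸ with translation symmetry — or the 4 × 4 torus t–J / U
= ∞ literature value). Stripe point / window: nothing cheap (numerics only); the refuter's check is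
the literature status of PureModelStripeCompetition (contested, ArovasBergKivelsonRaghu2022 §8.1)
and, for the box, Sorella2023 Fig. 12 at the corner (6, 1/6). NogoNoSaturationBelowExchange: a
two-line energy comparison — spinless-fermion (S_max) energy ≥ −4·#holes ≥ −4δL² − 8 versus n dimer
singlets at (U − √(U²+16))/2 ≤ −4/(U+2) each, n ≥ (1−δ)L²/2 − 1 — so a refuter can only object to
the typing (checked rc0 in Sketch.lean; IsGroundStateInSector carries ψ ≠ 0, so the '≠' conclusion
is not vacuous).

SUPPORT. NogoThesis (stmt-0167; pre-audit ¬S: U ≠ 0, δ ∈ (0, 1), all-sides hypotheses,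
¬HasPairFieldLRO) — logically INCOMPARABLE with ¬S (wider range; its all-sides liminf may dip along
odd sides only), reductions landed in Theorems/NoGoNogoThesis.lean (p38573), kept because those
theorems name it. NogoAttractiveExclusion (stmt-0169; U < 0) — OFF the line since the audit (S is U
> 0; no chain from U < 0 to the Statement is claimed; companion route PositivityPins retired
not-a-thesis 2026-08-15): an independent regional theorem (Lieb's spin-reflection positivity gives
the unique S = 0 ground state; clustering of the d-wave 4-point function is open, Lieb review
Problem 1). NogoNagaokaWindow (stmt-0170; all-sides typing, U-UNIFORM box ∃ U₁ δ₁ ∀ U > U₁ ∀ δ < δ₁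
— judged uncoverable by ferromagnetism since U_cr(δ) → ∞ as δ → 0; 'FM ⟹ it' is landed) and
NogoStripeWindow (stmt-0171; all-sides typing of #3) are superseded as cruxes by #2 / #3.
NogoSaturatedFmCorner (rev 7; registered hypothesis, audited typing; OPEN — Tasaki1998 §6.3:
extending Nagaoka's theorem to finite U and a finite density of holes 'is still not known', with
rigorous NON-saturation results in several situations, DoucotWen89/Shastry90/Toth91/Suto91b cited
there; expected threshold U₁(δ) → ∞ as δ → 0). NogoNoSaturationBelowExchange (rev 8; PROVABLE NOW,
the route's one prover-ready item): ∀ U > 0 ∀ δ ∈ (0, 1/(4(U+2))) ∀ᶠ L, Even L → no ground state ψ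
of the (2⌊(1−δ)L²/2⌋, S^z = 0) sector of hubbardTorus 2 L 1 U is saturated (spinSq ψ ≠ n(n+1)ψ, n =
⌊(1−δ)L²/2⌋). PROOF (finite L, elementary): (1) a saturated (S = n) sector eigenvector with
eigenvalue E lifts by (S⁺)ⁿ ≠ 0 to a fully polarised 2n-particle eigenvector with the same E, on
which U Σ n↑n↓ = 0, so E is a free spinless-fermion energy ≥ (sum of the 2n lowest hopping levels) =
−(sum of the L² − 2n highest) ≥ −4(L² − 2n) ≥ −4δL² − 8 (levels −2(cos k₁ + cos k₂) ∈ [−4, 4], trace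
0); (2) TRIAL STATE in the sector: L even ⇒ the torus is tiled by L²/2 horizontal dominoes; put the
two-site Hubbard singlet ground state (energy (U − √(U²+16))/2 ≤ −4/(U+2)) on n of them and leave
the rest empty — inter-domino hopping and all cross terms have zero expectation (particle number per
domino is fixed), so ⟨H⟩ = n(U − √(U²+16))/2 ≤ −2(1−δ)L²/(U+2) + 2; (3) δ < 1/(4(U+2)) gives 4δ <
1/(U+2) < 2(1−δ)/(U+2) − 3/(4(U+2)), hence ⟨H⟩_trial < −4δL² − 8 ≤ E for L² > 14(U+2): the sector
minimum lies strictly below every saturated eigenvalue, so no saturated state is a sector ground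
state. Consequences: the corner's threshold must satisfy U₁(δ) ≥ 1/(4δ) − 2 (Richmond–Rickayzen 1969
'U_cr → ∞ as δ → 0', quoted in Shastry–Krishnamurthy–Anderson 1990, book:editornd-hubbard-model
pp.205–207 with Fig. 2), and the U-uniform hFM is false (not_hFM_of_noSat). Tree tools: Su2Multiplet
/ FermionOperatorsSpinSqProofs (spin ladder), HubbardBondAlgebra / LocalPairOn (domino states),
exists_unit_groundStateInSector_hubbardTorus (sector minimum). NogoSingletPairKillsSaturatedFM
(stmt-0172) is PROVED (p39832) and DETACHED from the item list at rev 7: its `_holds` link forced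
the gate to import Theorems/NoGoNogoSingletPairKillsSaturatedFM.lean, which imports the Theses file
(cycle ⇒ route not materialisable, deciding theorem unauditable since rev 6). Consequence accepted
knowingly (as WeakCouplingBCS rev 2 did for WcbcsSectorBookkeeping): that module's theorem
nogoSingletPairKillsSaturatedFM_proof is typed by the detached decl and stops elaborating until a
prover re-types it structurally (∀ g L [NeZero L] N ψ, IsNParticle N ψ → spinSq ψ = (N/2)(N/2+1) ψ →
pairField g L ψ = 0; every lemma it rests on is already structural); port it together with the
corner glue, without importing the Theses file.

SOURCES. book:editornd-hubbard-model pp.198–209 (Shastry–Krishnamurthy–Anderson PRB 41 (1990) 2375;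
Richmond–Rickayzen J. Phys. C 2 (1969) 528; Fazekas et al. single-flip), KomaTasakiPRL1992,
Tasaki1998, Nagaoka1966, Tasaki1989, arXiv:cond-mat/9311033 (Lieb's 1993 review), QinEtAl2020,
XuEtAl2024, Sorella2023, MaierEtAl2005, RaghuKivelsonScalapino2010, ArovasBergKivelsonRaghu2022,
Scalapino1995, KomaTasaki1994.

Novelty: Nearest prior art (searched: lit search/vsearch/galaxy, barrier catalogue, references.bib): rigorous
NO-GO results for pairing order in Hubbard models are (a) positive temperature only —
KomaTasakiPRL1992 (arXiv:cond-mat/9709068) and, for the d_{x²-y²} channel by Bogoliubov's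
inequality, SuSuzuki1998 (arXiv:cond-mat/9801243), whose sole T=0 statement assumes a charge gap (=
contrapositive of KomaTasaki1994 'LRO forces gapless states'); (b) T=0 but d=1 —
PitaevskiiStringari1991; (c) T=0, d=2 but only inside the quasi-free variational class —
BachLiebSolovej1994 Thm 2.11 (no pairing in gHF for U≥0); (d) numerics — QinEtAl2020. Lieb's 1993
review (arXiv:cond-mat/9311033, Problems 1–4) and Tasaki1998 (arXiv:cond-mat/9512169 p.21) record
the regional questions as open. Delta: this route attacks ¬S for true ground states in d=2 by
REGIONAL exclusions over the (U,δ) plane, each with its own mechanism — U<0 via Lieb's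
spin-reflection-positivity uniqueness plus 4-point clustering; large U/small δ via saturated
(Nagaoka) ferromagnetism combined with the exact SU(2) selection rule 'a singlet pair field
annihilates every S=N/2 state' (pairFieldCorr ≡ 0, Tasaki1998 p.20 mechanism transplanted from H_int
to Δ_d); a numerics-anchored stripe window. No prior work found that uses saturated ferromagnetism
as a rigorous pair-LRO exclusion device at positive hole density, nor any regional T=0 assembly of
¬(d-wave GS LRO); the combination is new, the ingredients classical, and the FM leg is condi  [refs: cond-mat/9709068, cond-mat/9801243, cond-mat/9311033, cond-mat/9512169, KomaTasakiPRL1992, SuSuzuki1998, KomaTasaki1994, PitaevskiiStringari1991, BachLiebSolovej1994, QinEtAl2020, Tasaki1998]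

Barriers (technique_class: regional-exclusion spin-reflection-positivity Nagaoka-FM): - Literature.Barriers.HubbardSuperconductivity.LROForcesLowLyingStates: APPLIES to
NogoAttractiveExclusion — Lieb's unique C₄-symmetric finite-volume GS (U<0) is compatible with pair
LRO (tower of states): uniqueness/symmetry cannot give ¬LRO, real clustering is needed (open); the
contrapositive (charge gap ⇒ no LRO = SuSuzuki1998 at T=0) is unusable, no charge gap at 0<δ.
- Literature.Barriers.HubbardSuperconductivity.StrongCouplingCeiling: APPLIES to the large-|U|
corners (BEC expansion at U≪0; t/U expansion behind NogoNagaokaWindow): no convergent atomic-limit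
expansion reaches the SU(2)-symmetric GS; NagaokaWindow evades it only non-perturbatively
(connectivity saturation + SU(2) selection rule), i.e. by betting on the OPEN finite-density Nagaoka
ferromagnetism.
- Literature.Barriers.HubbardSuperconductivity.PureModelStripeCompetition: the evidence behind
support NogoStripeWindow; its 'contested' status is that item's why-might-fail.
- Literature.Barriers.HubbardSuperconductivity.SignProblemNPHard: no QMC certificate for
NogoStripeWindow; numerics stay cited evidence.
- Literature.Barriers.HubbardSuperconductivity.PositiveTemperatureNoPairLRO,
Literature.Barriers.HubbardSuperconductivity.HohenbergMerminWagnerPairing: unused — T>0 bounds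
degrade ∝1/β, KLS-type GS order exists in d=2; ¬S is not claimed as a Mermin–Wagner corollary.
- Literature.Barriers.HubbardSuperconductivity.WeakCouplingCeiling,
Literature.Barriers.HubbardSuperconductivity.PerturbativeInvisibilityOfPairi

History (route lifecycle, newest last):
- 2026-08-15T16:26:10Z · rev 5: restated Assembly (stmt-HubbardSuperconductivity-0168) — repair: Assembly restated to NogoThesisR → ¬HubbardSuperconductivity (the gate refuses --drop of an assembly item); old antecedent X_old (= NogoThesis, pre-audi (planner-rbadge-HubbardSuperconductivity-NoGo-c785e39d-g2-0)
- 2026-08-15T18:46:06Z · rev 7: dropped NogoSingletPairKillsSaturatedFM — rev 7 (tenure/priority repair): detach proved support NogoSingletPairKillsSaturatedFM (stmt-0172; its _holds link auto-imports Theorems/NoGoNogoSingletPairKills (planner-plan-HubbardSuperconductivity-g2-0)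
- 2026-08-16T03:32:20Z · CLOSED retired — not-a-thesis (route.target-unreachable, operator hold 2026-08-16T02:56:57Z): no crux reaches the target NogoThesisR = ¬S — the cruxes are regional restrictions OF the target, and no honest glue exists (planner-rchoice-HubbardSuperconductivity-NoGo--3c5203b9-0)

sub-problem: HubbardSuperconductivity · status: closed(retired) · opened planner-HubbardSuperconductivity-Survey-0 2026-08-13T06:04:33Z · rev 9 · ledger route-HubbardSuperconductivity-NoGo
GENERATED by the gate from the ledger (D-0016/17). Provers cite these decls: `theorem foo : Summit.HubbardSuperconductivity.HubbardSuperconductivity.Theses.NoGo.<Decl> := …` in Summits/HubbardSuperconductivity/HubbardSuperconductivity/Theorems/<Name>.lean.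
-/

namespace Summit.HubbardSuperconductivity.HubbardSuperconductivity.Theses.NoGo

open scoped BigOperators Topology Manifold Classical MeasureTheory ProbabilityTheory Matrix InnerProductSpace ComplexConjugate ContinuousMap
open Filter Set Function TopologicalSpace MeasureTheory

attribute [summit_statement] _root_.HubbardSuperconductivity

open Literature.Hubbard

/-- item stmt-HubbardSuperconductivity-2136 · target · rank 0 · open · by planner
why it might fail: Consensus FALSE at weak coupling: Kohn–Luttinger/RG give a d_{x²−y²} GS for 0<U≪t, 0.6<n<1, t'=0 (RKS2010 pp.2,6; ABKR2022 §9) ⇒ LRO for every GS sequence there. ↔ ¬S is proved, so refuting it = proving S.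
sources: RaghuKivelsonScalapino2010, ArovasBergKivelsonRaghu2022, QinEtAl2020, Scalapino1995
[target] ¬HubbardSuperconductivity pushed through the quantifiers in the AUDITED typing (0 < U, δ ∈
Ioo 0 (1/2), Even-L hypotheses, ¬ even-side HasLongRangeOrder of torusPullback (pairFieldCorr
dWaveFormFactor ψ)). Same mathematical statement as NoGo.NogoThesis
(stmt-HubbardSuperconductivity-0167, typed pre-audit with U ≠ 0, δ < 1, all L; grounder note
2026-08-14 asks for exactly this retyping); when NoGo restates, merge (one decl, two decompositions:
NoGo by (U,δ)-regions, this route by witness classes). Physics prior: FALSE at weak coupling. ||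
Sources: RaghuKivelsonScalapino2010, ArovasBergKivelsonRaghu2022, Scalapino1995. -/
@[route_item "route-HubbardSuperconductivity-NoGo"]
def NogoThesisR : Prop :=
  ∀ U : ℝ, 0 < U → ∀ δ ∈ Set.Ioo (0:ℝ) (1/2), ∃ (N : ℕ → ℕ) (ψ : ∀ L, Literature.MathematicalPhysics.QuantumLattice.Fock (Literature.MathematicalPhysics.QuantumLattice.Orb (Literature.MathematicalPhysics.QuantumLattice.FermionTorus 2 L))), (∀ L, Even L → N L = 2 * ⌊(1 - δ) * (L : ℝ) ^ 2 / 2⌋₊ ∧ star (ψ L) ⬝ᵥ ψ L = 1 ∧ Literature.MathematicalPhysics.QuantumLattice.IsGroundStateInSector (Literature.MathematicalPhysics.QuantumLattice.hubbardTorus 2 L 1 U) (N L) 0 (ψ L)) ∧ ¬ Literature.Probability.LatticeModels.HasLongRangeOrder (fun k => Literature.Probability.LatticeModels.halfOpenBox 2 (2 * k)) (fun k => Literature.MathematicalPhysics.QuantumLattice.torusPullback (Literature.MathematicalPhysics.QuantumLattice.pairFieldCorr Literature.MathematicalPhysics.QuantumLattice.dWaveFormFactor ψ) (2 * k))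

/-- item stmt-HubbardSuperconductivity-10833 · crux · rank 2 · closed · moot by None · by planner
why it might fail: Positive-density finite-U Nagaoka FM is OPEN (Tasaki1998 p.26) and doubted: 2 holes at U=∞ ⇒ saturated state NOT the GS on finite tori (Lieb 1993 review p.7 iii) and every summit sector has an even number ≥2 of holes; partial polarisation gets nothing from the selection rule.
sources: Tasaki1998, Nagaoka1966, Tasaki1989, arXiv:cond-mat/9311033, ArovasBergKivelsonRaghu2022, book:editornd-hubbard-model pp.200–209 (Shastry–Krishnamurthy–Anderson δ_cr = 0.49; two-hole instability refs)
[crux] NAGAOKA CORNER (audited typing; replaces the U-uniform NogoNagaokaWindow as crux): there is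
δ₁ ∈ (0, 1/2) such that for every δ ∈ (0, δ₁) there is U₁ = U₁(δ) with: for all U > U₁ some (N_L,
S^z = 0)-sector ground-state sequence (hypotheses at even L) has no even-side d_{x²−y²} pair-field
LRO. Mechanism: saturated ferromagnetism of the sector ground states for U ≫ t/δ (a
positive-density, finite-U Nagaoka theorem — OPEN, Tasaki1998 p.26) + the SU(2) selection rule
NogoSingletPairKillsSaturatedFM (PROVED, p39832) ⇒ Δ_d ψ_L = 0 identically ⇒ pairFieldCorr ≡ 0
(landed for the all-sides typing: nogoNagaokaWindow_of_saturatedFerromagnetism,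
pairFieldCorr_succ_eq_zero_of_saturated; the even-side version is the same argument). The S^z = 0
member of a ground-state multiplet with S = N_L/2 is a legitimate sector ground state; degeneracy
with other ground states is harmless ('some sequence'). Any other LRO-free witness (phase
separation, partially polarised states with controlled pair correlations) also proves it.
NogoThesisR ⟹ this (restriction; rc0). [deps: NogoSingletPairKillsSaturatedFM] [difficulty:
open-problem] -/
@[route_item "route-HubbardSuperconductivity-NoGo"]
def NogoNagaokaCorner : Prop :=
  ∃ δ₁ ∈ Set.Ioo (0:ℝ) (1/2), ∀ δ ∈ Set.Ioo (0:ℝ) δ₁, ∃ U₁ : ℝ, ∀ U : ℝ, U₁ < U → ∃ (N : ℕ → ℕ) (ψ : ∀ L, Literature.MathematicalPhysics.QuantumLattice.Fock (Literature.MathematicalPhysics.QuantumLattice.Orb (Literature.MathematicalPhysics.QuantumLattice.FermionTorus 2 L))), (∀ L, Even L → N L = 2 * ⌊(1 - δ) * (L : ℝ) ^ 2 / 2⌋₊ ∧ star (ψ L) ⬝ᵥ ψ L = 1 ∧ Literature.MathematicalPhysics.QuantumLattice.IsGroundStateInSector (Literature.MathematicalPhysics.QuantumLattice.hubbardTorus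 2 L 1 U) (N L) 0 (ψ L)) ∧ ¬ Literature.Probability.LatticeModels.HasLongRangeOrder (fun k => Literature.Probability.LatticeModels.halfOpenBox 2 (2 * k)) (fun k => Literature.MathematicalPhysics.QuantumLattice.torusPullback (Literature.MathematicalPhysics.QuantumLattice.pairFieldCorr Literature.MathematicalPhysics.QuantumLattice.dWaveFormFactor ψ) (2 * k))

/-- item stmt-HubbardSuperconductivity-10834 · crux · rank 3 · closed · moot by None · by planner
why it might fail: Finite-cylinder numerics only, TDL just at (8,1/8) (QinEtAl2020 Figs 5,9,11; CP bias); corner (6,1/6) contested: Sorella2023 Fig.12 d-wave at δ∈(0.17,0.239) for U=6, 0.003 above 1/6; interior unclaimed; MaierEtAl2005 DCA d-wave; ABKR2022 §8.1 'unsettled'; no rigorous tool at U≈8t.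
sources: QinEtAl2020, arXiv:1910.08931, Sorella2023, arXiv:2101.07045, XuEtAl2024, arXiv:2303.08376
[crux] STRIPE WINDOW (audited typing of NogoStripeWindow; verbatim the consequent of
SignStructure.StripeWindowMembership, stmt-HubbardSuperconductivity-2141): for every U ∈ [6, 8] and
δ ∈ [1/10, 1/6] some admissible (N_L, S^z = 0) ground-state sequence (hypotheses at even L) has no
even-side d_{x²−y²} pair-field LRO. Evidence numerical only (QinEtAl2020: filled stripes, decaying
pair correlations at U/t = 6–8, 0.1 < h < 0.2, t' = 0; XuEtAl2024: SC only with t' ≠ 0); the point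
(8, 1/8) is the catalogued open statement PureModelStripeCompetition = ¬HasDWavePairFieldLROAt 8
(1/8). No engine is filed in this route: PlateauExclusion (pair incompressibility),
AbsenceCertificate (sourced-order certificates), CoboundaryCeiling (coboundary ceiling),
SignStructure (JastrowSlaterNoDWaveLRO → this) carry engines, and a proof by any of them closes this
item via --supports. NogoThesisR ⟹ this (restriction; rc0). [difficulty: open-problem] -/
@[route_item "route-HubbardSuperconductivity-NoGo"]
def NogoStripeWindowR : Prop :=
  ∀ U ∈ Set.Icc (6:ℝ) 8, ∀ δ ∈ Set.Icc (1/10:ℝ) (1/6), ∃ (N : ℕ → ℕ) (ψ : ∀ L, Literature.MathematicalPhysics.QuantumLattice.Fock (Literature.MathematicalPhysics.QuantumLattice.Orb (Literature.MathematicalPhysics.QuantumLattice.FermionTorus 2 L))), (∀ L, Even L → N L = 2 * ⌊(1 - δ) * (L : ℝ) ^ 2 / 2⌋₊ ∧ star (ψ L) ⬝ᵥ ψ L = 1 ∧ Literature.MathematicalPhysics.QuantumLattice.IsGroundStateInSector (Literature.MathematicalPhysics.QuantumLattice.hubbardTorus 2 L 1 U) (N L) 0 (ψ L)) ∧ ¬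 Literature.Probability.LatticeModels.HasLongRangeOrder (fun k => Literature.Probability.LatticeModels.halfOpenBox 2 (2 * k)) (fun k => Literature.MathematicalPhysics.QuantumLattice.torusPullback (Literature.MathematicalPhysics.QuantumLattice.pairFieldCorr Literature.MathematicalPhysics.QuantumLattice.dWaveFormFactor ψ) (2 * k))

/-- item stmt-HubbardSuperconductivity-10962 · crux · rank 3 · closed · moot by None · by planner
why it might fail: TDL numerics at this one point only (QinEtAl2020 Fig.9: filled stripes, Δ_∞=0.003(6); CP bias) and contested: Sorella2023 Fig.12 d-wave at δ∈(0.19,0.25) for U=8, MaierEtAl2005 DCA d-wave, ABKR2022 §8.1 'unsettled'; ¬crux = S at (8,1/8); no rigorous tool at U=8t.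
sources: QinEtAl2020, arXiv:1910.08931, Sorella2023, arXiv:2101.07045, XuEtAl2024, MaierEtAl2005
[support] REGIONAL PAYOFF (restated rev 3, cone repair — the same Prop as before by Iff.rfl, now
spelled out): at U = 8, δ = 1/8 NOT every admissible sequence (N_L = 2⌊(7/8)L²/2⌋ at even L, ψ_L
normalised (N_L, S^z=0)-sector ground states of hubbardTorus 2 L 1 8) has d_{x²−y²} pair-field LRO
along even sides (HasLongRangeOrder of torusPullback (pairFieldCorr dWaveFormFactor ψ) (2k) over
halfOpenBox 2 (2k)) — i.e. ¬HasDWavePairFieldLROAt 8 (1/8), word for word the catalogued numerical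
no-go Literature.Barriers.HubbardSuperconductivity.PureModelStripeCompetition (QinEtAl2020 §III–IV:
filled λ = 8 stripes, Δ_∞(0) = 0.003(6); status contested — Sorella2023 vs XuEtAl2024; both Iff.rfl,
Sketch2.lean rc 0). The item no longer USES that constant nor imports its module:
PureModelStripeCompetition is a registered OPEN CONJECTURE (deliberately no `_holds`), and through
the old body `:= PureModelStripeCompetition` it sat in the route's dependency cone as
un-dischargeable named-fact debt (the staffing blocker this repair removes). Inside the route it is
reached by IncompressibilityExcludesPairing → StripePointIncompressibility → this (glue
`stripePointExclusion_of` proved in the planner's Sketc -/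
@[route_item "route-HubbardSuperconductivity-NoGo"]
def NogoStripePoint : Prop :=
  ¬ (∀ (N : ℕ → ℕ) (ψ : ∀ L, Literature.MathematicalPhysics.QuantumLattice.Fock (Literature.MathematicalPhysics.QuantumLattice.Orb (Literature.MathematicalPhysics.QuantumLattice.FermionTorus 2 L))), (∀ L, Even L → N L = 2 * ⌊(1 - 1 / 8) * (L : ℝ) ^ 2 / 2⌋₊ ∧ star (ψ L) ⬝ᵥ ψ L = 1 ∧ Literature.MathematicalPhysics.QuantumLattice.IsGroundStateInSector (Literature.MathematicalPhysics.QuantumLattice.hubbardTorus 2 L 1 8) (N L) 0 (ψ L)) → Literature.Probability.LatticeModels.HasLongRangeOrder (fun k => Literature.Probability.LatticeModels.halfOpenBox 2 (2 * k)) (fun k => Literature.MathematicalPhysics.QuantumLattice.torusPullback (Literature.MathematicalPhysics.QuantumLattice.pairFieldCorr Literature.MathematicalPhysics.QuantumLattice.dWaveFormFactor ψ) (2 * k)))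

/-- item stmt-HubbardSuperconductivity-0167 · support · rank 0 · closed · moot by None · by planner
why it might fail: Prior FALSE for small U>0, δ<0.4 (weak-coupling RG d_{x²−y²} GS, RKS2010 pp.2,6); as typed it is the open problem at EVERY (U,δ) incl. U<0, δ≥1/2, and it does not imply ¬S (odd-side gap).
sources: RaghuKivelsonScalapino2010, ArovasBergKivelsonRaghu2022, Summits/HubbardSuperconductivity/HubbardSuperconductivity/Theorems/NoGoNogoThesis.lean
Negation of HubbardSuperconductivity pushed through the quantifiers. Physics prior: FALSE at weak
coupling (Kohn–Luttinger d-wave); value = regional exclusion theorems + refuter pressure on S's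
quantifier structure (every GS, all L incl. odd, S^z=0 sector, U<0 admitted, t'=0). || Sources:
KomaTasaki1992, QinEtAl2020, RaghuKivelsonScalapino2010. || UNELABORATED: `lean check` impossible on
2026-08-13 ~06:00Z (build artefact
Literature/MathematicalPhysics/QuantumLattice/FermionOperators.olean missing; planner may not run
lake build). Written in the exact syntax of Summits/HubbardSuperconductivity/Statement.lean with
fully qualified names; refuter please elaborate. -/
@[route_item "route-HubbardSuperconductivity-NoGo", crux]
def NogoThesis : Prop :=
  ∀ U : ℝ, U ≠ 0 → ∀ δ ∈ Set.Ioo (0:ℝ) 1, ∃ (N : ℕ → ℕ) (ψ : ∀ L, Literature.MathematicalPhysics.QuantumLattice.Fock (Literature.MathematicalPhysics.QuantumLattice.Orb (Literature.MathematicalPhysics.QuantumLattice.FermionTorus 2 L))), (∀ L, N L = 2 * ⌊(1 - δ) * (L : ℝ) ^ 2 / 2⌋₊ ∧ star (ψ L) ⬝ᵥ ψ L = 1 ∧ Literature.MathematicalPhysics.QuantumLattice.IsGroundStateInSector (Literature.MathematicalPhysics.QuantumLattice.hubbardTorus 2 L 1 U) (N L) 0 (ψ L)) ∧ ¬ Literature.MathematicalPhysics.QuantumLattice.HasPairFieldLRO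 Literature.MathematicalPhysics.QuantumLattice.dWaveFormFactor N ψ

/-- item stmt-HubbardSuperconductivity-0169 · support · rank 2 · closed · moot by None · by planner
why it might fail: Uniqueness + C₄ of Lieb's S=0 GS cannot exclude 4-point d-wave LRO (tower of states, Tasaki1998 p.15); needs real clustering = rigorous BCS–BEC GS at 0<δ<1 in d=2 (Lieb 1993 Problem 1, open).
sources: LiebPRL1989, arXiv:cond-mat/9311033, Tasaki1998, Literature.Barriers.HubbardSuperconductivity.LROForcesLowLyingStates
U<0: Lieb's Theorem 1 (spin-reflection positivity) gives a unique S=0 ground state for even N on the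
connected torus graph (L ≥ 3, t = 1 ≠ 0), so 'some GS' = 'the GS'. Physics: on-site s-wave BCS–BEC
superconductor; the d-wave 4-point function should cluster onto |Σ_e g_d(e) F(e)|² = 0 by
C₄-invariance of the unique GS (F = anomalous n.n. amplitude in the symmetry-broken description). No
sign problem (determinant QMC weights ≥ 0) — the most reachable regional theorem; tools: Lieb
spin-space RP, Kubo–Kishi-type Gaussian domination in spin space, cluster/BEC expansions at large
|U|. || Sources: LiebPRL1989, KuboKishi1990, Tasaki1998. || UNELABORATED: `lean check` impossible on
2026-08-13 ~06:00Z (build artefact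
Literature/MathematicalPhysics/QuantumLattice/FermionOperators.olean missing; planner may not run
lake build). Written in the exact syntax of Summits/HubbardSuperconductivity/Statement.lean with
fully qualified names; refuter please elaborate. -/
@[route_item "route-HubbardSuperconductivity-NoGo"]
def NogoAttractiveExclusion : Prop :=
  ∀ U : ℝ, U < 0 → ∀ δ ∈ Set.Ioo (0:ℝ) 1, ∃ (N : ℕ → ℕ) (ψ : ∀ L, Literature.MathematicalPhysics.QuantumLattice.Fock (Literature.MathematicalPhysics.QuantumLattice.Orb (Literature.MathematicalPhysics.QuantumLattice.FermionTorus 2 L))), (∀ L, N L = 2 * ⌊(1 - δ) * (L : ℝ) ^ 2 / 2⌋₊ ∧ star (ψ L) ⬝ᵥ ψ L = 1 ∧ Literature.MathematicalPhysics.QuantumLattice.IsGroundStateInSector (Literature.MathematicalPhysics.QuantumLattice.hubbardTorus 2 L 1 U) (N L) 0 (ψ L)) ∧ ¬ Literature.MathematicalPhysics.QuantumLattice.HasPairFieldLRO Literature.MathematicalPhysics.QuantumLattice.dWaveFormFactor N ψ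

/-- item stmt-HubbardSuperconductivity-0170 · support · rank 3 · closed · moot by None · by planner
why it might fail: Needs an LRO-free witness for ALL U>U₁ at every δ<δ₁ incl. δ→0 at fixed U, where the GS is a lightly doped antiferromagnet, not a ferromagnet (Richmond–Rickayzen: U_cr→∞ as δ→0); finite-density Nagaoka FM open (Tasaki1998 p.26).
sources: Tasaki1998, arXiv:cond-mat/9311033, book:editornd-hubbard-model pp.200–209, ArovasBergKivelsonRaghu2022
If for (U,δ) in the window and all large L the (N_L, S^z=0) sector contains a SATURATED
ferromagnetic ground state (S = N_L/2; the S^z=0 member of the top multiplet), crux #5 gives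
⟨Δ_d†Δ_d⟩ = 0 identically along that sequence. Nagaoka (1966)/Tasaki (1989): saturated FM for
exactly one hole at U = ∞ on the torus; stability at positive hole density and finite U is OPEN
(variational instability known for δ ≳ 0.3 at U = ∞). Any proved sub-window is a theorem of
independent interest. || Sources: Nagaoka1966, Tasaki1989, Tasaki1998. || UNELABORATED: `lean check`
impossible on 2026-08-13 ~06:00Z (build artefact
Literature/MathematicalPhysics/QuantumLattice/FermionOperators.olean missing; planner may not run
lake build). Written in the exact syntax of Summits/HubbardSuperconductivity/Statement.lean with
fully qualified names; refuter please elaborate. -/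
@[route_item "route-HubbardSuperconductivity-NoGo"]
def NogoNagaokaWindow : Prop :=
  ∃ U₁ : ℝ, ∃ δ₁ ∈ Set.Ioo (0:ℝ) 1, ∀ U : ℝ, U₁ < U → ∀ δ ∈ Set.Ioo (0:ℝ) δ₁, ∃ (N : ℕ → ℕ) (ψ : ∀ L, Literature.MathematicalPhysics.QuantumLattice.Fock (Literature.MathematicalPhysics.QuantumLattice.Orb (Literature.MathematicalPhysics.QuantumLattice.FermionTorus 2 L))), (∀ L, N L = 2 * ⌊(1 - δ) * (L : ℝ) ^ 2 / 2⌋₊ ∧ star (ψ L) ⬝ᵥ ψ L = 1 ∧ Literature.MathematicalPhysics.QuantumLattice.IsGroundStateInSector (Literature.MathematicalPhysics.QuantumLattice.hubbardTorus 2 L 1 U) (N L) 0 (ψ L)) ∧ ¬ Literature.MathematicalPhysics.QuantumLattice.HasPairFieldLRO Literature.MathematicalPhysics.QuantumLattice.dWaveFormFactor N ψ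

/-- item stmt-HubbardSuperconductivity-0171 · support · rank 4 · closed · moot by None · by planner
why it might fail: Numerical evidence only (DMRG+AFQMC, QinEtAl2020) and contested (MaierEtAl2005 DCA d-wave; Sorella2023); finite-cluster numerics are no certificate at U>0 (SignProblemNPHard); the box [6,8]×[1/10,1/6] is the planner's — printed regime is U/t≈6–8, 0.1<h<0.2.
sources: QinEtAl2020 = arXiv:1910.08931 p.1 (abstract: 'non-superconducting in the moderate to strong coupling regime in the vicinity of optimal hole doping'), p.2 ('U/t around 6-8 and dopings 0.1 < h < 0.2 … not superconducting'), p.9 ('no long-range SC pairing in this system in the TDL'), XuEtAl2024 = arXiv:2303.08376 p.1 (SC with t′≠0; 'superconductivity is absent in the pure … Hubbard model'), Literature.Barriers.HubbardSuperconductivity.PureModelStripeCompetition (status contested: MaierEtAl2005 = arXiv:cond-mat/0504529, Sorella2023 = arXiv:2101.07045, DengEtAl2015 = arXiv:1408.2088), Literature.Barriers.HubbardSuperconductivity.SignProblemNPHard (no unbiased polynomial-time QMC certificate for the doped repulsive model), ArovasBergKivelsonRaghu2022 = arXiv:2103.12097 p.31 §8.1 ('presently unsettled')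
Numerical consensus (DMRG + constrained-path AFQMC, Simons collaboration): the pure t'=0 Hubbard
model at U ≈ 6–8, δ ≈ 1/8 has a filled-stripe ground state and pair correlations decaying without
LRO (Qin et al. 2020); SC (re)appears only with t' ≠ 0 (Xu et al. 2024). No rigorous tool known;
filed so refuters/grounders can attach evidence and so S-side routes avoid this box. || Sources:
QinEtAl2020, XuEtAl2024, ArovasBergKivelsonRaghu2022. || UNELABORATED: `lean check` impossible on
2026-08-13 ~06:00Z (build artefact
Literature/MathematicalPhysics/QuantumLattice/FermionOperators.olean missing; planner may not run
lake build). Written in the exact syntax of Summits/HubbardSuperconductivity/Statement.lean with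
fully qualified names; refuter please elaborate. -/
@[route_item "route-HubbardSuperconductivity-NoGo"]
def NogoStripeWindow : Prop :=
  ∀ U : ℝ, U ∈ Set.Icc (6:ℝ) 8 → ∀ δ ∈ Set.Icc (1/10:ℝ) (1/6), ∃ (N : ℕ → ℕ) (ψ : ∀ L, Literature.MathematicalPhysics.QuantumLattice.Fock (Literature.MathematicalPhysics.QuantumLattice.Orb (Literature.MathematicalPhysics.QuantumLattice.FermionTorus 2 L))), (∀ L, N L = 2 * ⌊(1 - δ) * (L : ℝ) ^ 2 / 2⌋₊ ∧ star (ψ L) ⬝ᵥ ψ L = 1 ∧ Literature.MathematicalPhysics.QuantumLattice.IsGroundStateInSector (Literature.MathematicalPhysics.QuantumLattice.hubbardTorus 2 L 1 U) (N L) 0 (ψ L)) ∧ ¬ Literature.MathematicalPhysics.QuantumLattice.HasPairFieldLRO Literature.MathematicalPhysics.QuantumLattice.dWaveFormFactor N ψ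

/-- item stmt-HubbardSuperconductivity-11937 · support · rank 9 · closed · moot by None · by planner
why it might fail: OPEN beyond one hole (Tasaki1998 §6.3: finite U / finite hole density 'still not known'; non-saturation theorems DoucotWen89, Shastry90, Toth91, Suto91b): two holes at U=∞ already unsaturate finite tori (Lieb review p.7 iii); SKA instability δ>0.49→0.29; U₁(δ)→∞ as δ→0.
sources: Tasaki1998 §6.3 (arXiv:cond-mat/9512169), Nagaoka1966, Tasaki1989, arXiv:cond-mat/9311033 p.7 (iii), book:editornd-hubbard-model pp.200–209 (Shastry–Krishnamurthy–Anderson), ArovasBergKivelsonRaghu2022 §5.2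
[support] REGISTERED INPUT of the rank-2 corner (needs_repair tree.conditional, rev 7):
positive-density, finite-U SATURATED (Nagaoka) ferromagnetism in the AUDITED typing — there is δ₁ ∈
(0,1/2) such that for every δ ∈ (0,δ₁) there is U₁ = U₁(δ) with: for all U > U₁ and all large EVEN
sides L the (2⌊(1−δ)L²/2⌋, S^z=0) sector of hubbardTorus 2 L 1 U contains a ground state of maximal
total spin S = N_L/2 (S²ψ = n(n+1)ψ, n = N_L/2: the S^z=0 member of the top multiplet). Together
with the PROVED selection rule (a singlet pair field kills every S_max state, so pairFieldCorr ≡ 0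
along saturated members: Theorems/NoGoNogoSingletPairKillsSaturatedFM.lean, p39832) it yields the
crux NogoNagaokaCorner — kernel-checked in the planner's Sketch.lean (corner_of_fmCorner, rc0); a
prover ports that glue into Theorems with --supports NogoNagaokaCorner and WITHOUT importing the
Theses file. Doping-dependent threshold on purpose (J = 4t²/U must lose to the hole kinetic gain ∝
δt, so U₁(δ) → ∞ as δ → 0); the U-uniform pre-audit version (hypothesis hFM of
nogoNagaokaWindow_of_saturatedFerromagnetism, targeting support NogoNagaokaWindow) is not
registered. OPEN beyond one hole at U = ∞ (Nagaoka 1966, -/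
@[route_item "route-HubbardSuperconductivity-NoGo"]
def NogoSaturatedFmCorner : Prop :=
  ∃ δ₁ ∈ Set.Ioo (0:ℝ) (1/2), ∀ δ ∈ Set.Ioo (0:ℝ) δ₁, ∃ U₁ : ℝ, ∀ U : ℝ, U₁ < U → ∀ᶠ L : ℕ in Filter.atTop, Even L → ∃ ψ : Literature.MathematicalPhysics.QuantumLattice.Fock (Literature.MathematicalPhysics.QuantumLattice.Orb (Literature.MathematicalPhysics.QuantumLattice.FermionTorus 2 L)), Literature.MathematicalPhysics.QuantumLattice.IsGroundStateInSector (Literature.MathematicalPhysics.QuantumLattice.hubbardTorus 2 L 1 U) (2 * ⌊(1 - δ) * (L : ℝ) ^ 2 / 2⌋₊) 0 ψ ∧ Matrix.mulVec Literature.MathematicalPhysics.QuantumLattice.spinSq ψ = (((⌊(1 - δ) * (L : ℝ) ^ 2 / 2⌋₊ : ℝ) * ((⌊(1 - δ) * (L : ℝ) ^ 2 / 2⌋₊ : ℝ) + 1) : ℝ) : ℂ) • ψ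

/-- item stmt-HubbardSuperconductivity-13708 · support · rank 9 · closed · moot by None · by planner
why it might fail: Provable now; risk is typing only: the S^z=0-sector minimum could in principle equal a saturated level by accident — excluded strictly by the margin 3L²/(4(U+2)) − 10 > 0 for L² > 14(U+2).
sources: book:editornd-hubbard-model, Tasaki1998, Nagaoka1966, arXiv:cond-mat/9512169
[support] NO SATURATION BELOW THE EXCHANGE SCALE (rev 8; provable now, elementary, finite L): for
every U > 0 and δ ∈ (0, 1/(4(U+2))), for all large L, if L is even then NO ground state ψ of the
(2n, S^z = 0) sector of hubbardTorus 2 L 1 U, n = ⌊(1−δ)L²/2⌋, is saturated: spinSq ψ ≠ n(n+1)ψ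
(IsGroundStateInSector carries ψ ≠ 0, so this is not vacuous). PROOF: (1) a saturated sector
eigenvector with eigenvalue E lifts by (S⁺)ⁿ ≠ 0 to a fully polarised 2n-particle eigenvector with
the same E; there U Σ n↑n↓ = 0, so E is a free spinless-fermion energy ≥ (sum of the 2n lowest
hopping levels −2(cos k₁ + cos k₂)) = −(sum of the L² − 2n highest) ≥ −4(L² − 2n) ≥ −4δL² − 8; (2)
trial state IN the sector: L even ⇒ L²/2 horizontal dominoes tile the torus; put the two-site
Hubbard singlet ground state (energy (U − √(U²+16))/2 ≤ −4/(U+2)) on n of them, leave the rest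
empty; inter-domino hopping has zero expectation (fixed particle number per domino), so ⟨H⟩ = n(U −
√(U²+16))/2 ≤ −2(1−δ)L²/(U+2) + 2; (3) δ < 1/(4(U+2)) ⇒ ⟨H⟩_trial < −4δL² − 8 ≤ E once L² > 14(U+2),
so the sector minimum lies strictly below every saturated eigenvalue. CONSEQUENCES: the
doping-dependent threshold of NogoSaturatedFm -/
@[route_item "route-HubbardSuperconductivity-NoGo"]
def NogoNoSaturationBelowExchange : Prop :=
  ∀ U : ℝ, 0 < U → ∀ δ ∈ Set.Ioo (0:ℝ) (1 / (4 * (U + 2))), ∀ᶠ L : ℕ in Filter.atTop, Even L → ∀ ψ : Literature.MathematicalPhysics.QuantumLattice.Fock (Literature.MathematicalPhysics.QuantumLattice.Orb (Literature.MathematicalPhysics.QuantumLattice.FermionTorus 2 L)), Literature.MathematicalPhysics.QuantumLattice.IsGroundStateInSector (Literature.MathematicalPhysics.QuantumLattice.hubbardTorus 2 L 1 U) (2 * ⌊(1 - δ) * (L : ℝ) ^ 2 / 2⌋₊) 0 ψ → Matrix.mulVec Literature.MathematicalPhysics.QuantumLattice.spinSq ψ ≠ (((⌊(1 - δ) * (L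 : ℝ) ^ 2 / 2⌋₊ : ℝ) * ((⌊(1 - δ) * (L : ℝ) ^ 2 / 2⌋₊ : ℝ) + 1) : ℝ) : ℂ) • ψ

-- earlier Assembly (stmt-HubbardSuperconductivity-0168, replaced 2026-08-15T16:26:10Z -> stmt-HubbardSuperconductivity-10871): retired by None — (∀ U : ℝ, U ≠ 0 → ∀ δ ∈ Set.Ioo (0:ℝ) 1, ∃ (N : ℕ → ℕ) (ψ : ∀ L, Literature.MathematicalPhysics.QuantumLattice.Fock (Literature.MathematicalPhysics.QuantumLattice.Orb (Literature.MathematicalPhysics.QuantumLattice.FermionTorus 2 L))), (∀ L, N L = 2 * ⌊(1 - 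
/-- item stmt-HubbardSuperconductivity-10871 · assembly · rank 1 · closed · moot by None · by planner
[assembly] Pure logic, identical to the deciding theorem `closes` (rintro ⟨U, hU, δ, hδ, hall⟩;
obtain ⟨N, ψ, hyp, hno⟩ := h U hU δ hδ; exact hno (hall N ψ hyp) — rc0). Restated 2026-08-15 from
the pre-audit `X_old → ¬HubbardSuperconductivity` (X_old = NogoThesis: U ≠ 0, δ < 1, all-sides
¬HasPairFieldLRO), which stopped being logic at the 2026-08-13 Statement audit (odd-side gap; prover
census CENSUS-0168 on stmt-0168; Theorems/NoGoNogoThesis.lean not_hubbardSuperconductivity_iff). ||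
Sources: Scalapino1995. -/
@[route_item "route-HubbardSuperconductivity-NoGo"]
def Assembly : Prop :=
  NogoThesisR → ¬ HubbardSuperconductivity

-- records of items no longer active in this route (dropped / restated):
-- earlier NogoSingletPairKillsSaturatedFM (stmt-HubbardSuperconductivity-0172, dropped 2026-08-15T18:46:06Z): proved by Summit.HubbardSuperconductivity.NoGo.nogoSingletPairKillsSaturatedFM_proof — ∀ (g : Literature.Probability.LatticeModels.Site 2 → ℝ) (L : ℕ) [NeZero L] (N : ℕ) (ψ : Literature.MathematicalPhysics.QuantumLattice.Fock (Literature.MathematicalPhysics.QuantumLattice.Orb (Literature.Mat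

end Summit.HubbardSuperconductivity.HubbardSuperconductivity.Theses.NoGo
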